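import Summits.ResolutionOfSingularities.ResolutionOfSingularities.Theorems.FrobeniusClosingSteerCurveEscapeStep
import HarnessLib

/-!
# Crux `Steer` (stmt-ResolutionOfSingularities-16345), chain W4.1, σ-residual SUPPORT: **CurveEscape, residue
# images of one quadratic transform** (helper γ, part 5; Theses-free, def-free)

OURS (campaign `res-hironaka`, rung L ★L-G4, slot W4.1; a statement about the route's own objects — quadratic
transforms of local rings along a valuation ring (`Resolution.IsQuadraticTransformAlong`); it replaces the role of
no printed item and is NOT a statement of the manuscript under review [claim: Hironaka2017, status: under-review];
AI review is weaker than expert review). res-L0-w41-plan-1 RULING 14 (14e) (HOME/STATUS 2026-08-27T08:16:00Z): GO for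
the γ-bridge `curveEscape_of_finite_integralClosure` (part 6, `FrobeniusClosingSteerCurveEscapeResidue.lean`); seat
res-type-038.

## Content (generic in a pair of ring maps to a field)

ONE quadratic transform `R → R'` along `O` (exceptional parameter `x`, `O` dominating `R`), primes
`P' ∩ R = P ≠ 𝔪_R`, and ring maps `g : R → κ`, `g' : R' → κ` to a field `κ`, compatible on `R`, with
`ker g = P` (in the application: the residue maps to the residue field of the common local ring `(R 0)_{P 0}` of
part 4, whose images ARE the residue rings `R ⧸ P`, `R' ⧸ P'` of the followed curve):
* `rangeRestrict_mem_maximalIdeal_iff`, `maximalIdeal_range_eq_map`, `fg_maximalIdeal_range` — the image ring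
  `g(R)` is local with maximal ideal the image of `𝔪_R` (finitely generated if `𝔪_R` is);
* `range_le_range`, `range_dominates` — `g(R) ⊆ g'(R')` is DOMINATED (a unit `g r` of `g'(R')` gives
  `incl r · r' ≡ 1` modulo the proper ideal `ker g'`, so `r` is a unit of `R'`, of `O`, of `R`);
* `isQuadraticTransform_range` — **`g'(R')` is a quadratic transform of `g(R)`** in Cutkosky's sense
  (`Resolution.IsQuadraticTransform`): exceptional parameter `g x ≠ 0`, the chart `g(R)[𝔪/g x]` lies in `g'(R')`
  (`y/x ∈ R'` maps to `g y / g x`), the image of `R[𝔪_R/x] ⊆ R'` lies in the chart (a closure argument through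
  the subring `(g')⁻¹(chart)`), and every element of `g'(R')` is a quotient of two chart elements with unit
  denominator (the shape `y/w`, `v w = 1`, of the elements of `R' = (R[𝔪_R/x])_{𝔪_O ∩ …}`).
With `IsQuadraticTransform.along` (tree) this makes the residue images a quadratic sequence along any valuation
ring of `κ` dominating them (part 6).

Def-free, sorry-free; imports part 1 only.
-/

noncomputable section

set_option linter.dupNamespace false

namespace Summit.ResolutionOfSingularities.ResolutionOfSingularities.Theorems.SwitchingDichotomy.CurveEscape

open IsLocalRing Literature.AlgebraicGeometry.Resolution

universe u

variable {K : Type u} [Field K]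

/-! ## §10 Residue images of one quadratic transform under compatible maps to a field -/

section Residue

variable {O : ValuationSubring K} {R R' : Subring K} [IsLocalRing R] [IsLocalRing R']
  {κ : Type*} [Field κ] (g : R →+* κ) (g' : R' →+* κ)

omit [IsLocalRing R'] in
/-- For a ring map `g : R → κ` from a local ring to a field, `g r` is a non-unit of the image ring iff `r` is a
non-unit of `R` (the kernel is a proper ideal). OURS bookkeeping. [folklore] -/
theorem rangeRestrict_mem_maximalIdeal_iff [IsLocalRing g.range] (r : R) :
    g.rangeRestrict r ∈ maximalIdeal g.range ↔ r ∈ maximalIdeal R := by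
  constructor
  · intro hmem
    by_contra hr
    have hu : IsUnit r := not_not.mp fun h => hr ((IsLocalRing.mem_maximalIdeal _).mpr h)
    exact (IsLocalRing.mem_maximalIdeal _).mp hmem (hu.map g.rangeRestrict)
  · intro hr
    rw [IsLocalRing.mem_maximalIdeal, mem_nonunits_iff]
    intro hu
    obtain ⟨w, hw⟩ := hu.exists_right_inv
    obtain ⟨r'', rfl⟩ := g.rangeRestrict_surjective w
    rw [← map_mul, ← map_one g.rangeRestrict] at hw
    have h1 : g (r * r'') = g 1 := by
      have := congrArg (fun z : g.range => (z : κ)) hw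
      simpa only [RingHom.coe_rangeRestrict] using this
    have h2 : r * r'' - 1 ∈ RingHom.ker g := by
      rw [RingHom.mem_ker, map_sub, h1, sub_self]
    have hker : RingHom.ker g ≠ ⊤ := RingHom.ker_ne_top g
    have h3 : IsUnit (r * r'') := by
      apply IsLocalRing.isUnit_of_mem_nonunits_one_sub_self
      have h4 : (1 : R) - r * r'' = -(r * r'' - 1) := by ring
      rw [h4]
      exact (IsLocalRing.mem_maximalIdeal _).mp (IsLocalRing.le_maximalIdeal hker ((RingHom.ker g).neg_mem h2))
    exact (IsLocalRing.mem_maximalIdeal _).mp hr (isUnit_of_mul_isUnit_left h3)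

omit [IsLocalRing R'] in
/-- The maximal ideal of the image ring is the image of the maximal ideal. OURS bookkeeping. [folklore] -/
theorem maximalIdeal_range_eq_map [IsLocalRing g.range] :
    maximalIdeal g.range = (maximalIdeal R).map g.rangeRestrict := by
  apply le_antisymm
  · intro z hz
    obtain ⟨r, rfl⟩ := g.rangeRestrict_surjective z
    exact Ideal.mem_map_of_mem _ ((rangeRestrict_mem_maximalIdeal_iff g r).mp hz)
  · rw [Ideal.map_le_iff_le_comap]
    intro r hr
    exact Ideal.mem_comap.mpr ((rangeRestrict_mem_maximalIdeal_iff g r).mpr hr)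

omit [IsLocalRing R'] in
/-- The maximal ideal of the image ring is finitely generated if `𝔪_R` is. OURS bookkeeping. [folklore] -/
theorem fg_maximalIdeal_range [IsLocalRing g.range] (hfg : (maximalIdeal R).FG) :
    (maximalIdeal g.range).FG := by
  rw [maximalIdeal_range_eq_map g]
  exact hfg.map _

omit [IsLocalRing R] [IsLocalRing R'] in
/-- Compatible maps have nested images. OURS bookkeeping. [folklore] -/
theorem range_le_range (hle : R ≤ R') (hgg' : ∀ r : R, g' (Subring.inclusion hle r) = g r) :
    g.range ≤ g'.range := by
  rintro _ ⟨r, rfl⟩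
  exact ⟨Subring.inclusion hle r, hgg' r⟩

omit [IsLocalRing R] in
/-- **The image of `R` is dominated by the image of `R'`** (when `O` dominates `R` and `R' ⊆ O` is local with the
kernel of `g'` a proper ideal): a unit `g r` of the bigger image gives `incl r · r' ≡ 1` modulo `ker g' ⊆ 𝔪_{R'}`,
so `r` is a unit of `R'`, of `O`, of `R`. OURS. [folklore] -/
theorem range_dominates (hle : R ≤ R') (hR'O : R' ≤ O.toSubring) (hRO : SubringDominates R O.toSubring)
    (hgg' : ∀ r : R, g' (Subring.inclusion hle r) = g r) :
    SubringDominates g.range g'.range := by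
  refine ⟨range_le_range g g' hle hgg', ?_⟩
  rintro _ ⟨r, rfl⟩ hzinv
  by_cases hr0 : g r = 0
  · rw [hr0, inv_zero]; exact g.range.zero_mem
  obtain ⟨r', hr'⟩ := hzinv
  have h1 : g' (Subring.inclusion hle r * r') = 1 := by
    rw [map_mul, hgg', hr', mul_inv_cancel₀ hr0]
  have h2 : Subring.inclusion hle r * r' - 1 ∈ RingHom.ker g' := by
    rw [RingHom.mem_ker, map_sub, h1, map_one, sub_self]
  have h3 : IsUnit (Subring.inclusion hle r * r') := by
    apply IsLocalRing.isUnit_of_mem_nonunits_one_sub_self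
    have h4 : (1 : R') - Subring.inclusion hle r * r' = -(Subring.inclusion hle r * r' - 1) := by ring
    rw [h4]
    exact (IsLocalRing.mem_maximalIdeal _).mp
      (IsLocalRing.le_maximalIdeal (RingHom.ker_ne_top g') ((RingHom.ker g').neg_mem h2))
  have h4 : IsUnit (Subring.inclusion hle r) := isUnit_of_mul_isUnit_left h3
  rw [isUnit_subring_iff_inv_mem] at h4
  have hrinv : ((r : R) : K)⁻¹ ∈ R := hRO.2 _ r.2 (hR'O h4.2)
  refine ⟨⟨((r : R) : K)⁻¹, hrinv⟩, ?_⟩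
  have h5 : (⟨((r : R) : K)⁻¹, hrinv⟩ : R) * r = 1 := Subtype.ext (inv_mul_cancel₀ h4.1)
  have h6 : g ⟨((r : R) : K)⁻¹, hrinv⟩ * g r = 1 := by rw [← map_mul, h5, map_one]
  exact eq_inv_of_mul_eq_one_left h6

/-- **The residue images form a quadratic transform.** One quadratic transform `R → R'` along `O` with `O`
dominating `R`, primes `P' ∩ R = P ≠ 𝔪_R`, and ring maps `g : R → κ`, `g' : R' → κ` to a field, compatible on
`R`, with kernels `P`, `P'`: then the image ring `g'(R')` is a quadratic transform of `g(R)` (Cutkosky's sense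
`IsQuadraticTransform`): the exceptional parameter is `g x`, the chart `g(R)[𝔪/g x]` lies in `g'(R')`
(`y/x ∈ R'`), every element of `g'(R')` is a quotient of two elements of the chart with unit denominator (the
shape `y/w`, `v w = 1`, of the elements of `R'`), and `g'(R')` dominates `g(R)`. OURS. [folklore] -/
theorem isQuadraticTransform_range [IsLocalRing g.range] [IsLocalRing g'.range]
    (h : IsQuadraticTransformAlong O R R') (hRO : SubringDominates R O.toSubring) {x : R}
    (hx : x ∈ maximalIdeal R) (hx0 : x ≠ 0) (hR' : R' = locAtCentre (blowupRing R (x : K)) O)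
    {P : Ideal R} {P' : Ideal R'} [P'.IsPrime] (hP : P ≠ maximalIdeal R)
    (hc : P'.comap (Subring.inclusion h.le) = P) (hker : RingHom.ker g = P)
    (hgg' : ∀ r : R, g' (Subring.inclusion h.le r) = g r) :
    IsQuadraticTransform g.range g'.range := by
  classical
  have hx0' : (x : K) ≠ 0 := fun e => hx0 (Subtype.ext e)
  have hxP : Subring.inclusion h.le x ∉ P' := not_mem_of_comap_eq h hx0 hR' hP hc
  have hxker : x ∉ P := fun hmem => hxP (by rw [← Ideal.mem_comap, hc]; exact hmem)
  have hgx0 : g x ≠ 0 := fun e => hxker (hker ▸ (RingHom.mem_ker.mpr e))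
  -- the exceptional parameter of the image
  set xb : g.range := g.rangeRestrict x with hxb
  have hxbK : (xb : κ) = g x := rfl
  have hxb𝔪 : xb ∈ maximalIdeal g.range := (rangeRestrict_mem_maximalIdeal_iff g x).mpr hx
  have hxb0 : xb ≠ 0 := fun e => hgx0 (by rw [← hxbK, e]; rfl)
  have hle := range_le_range g g' h.le hgg'
  -- `g(y)/g(x) = g'(y/x)` for `y ∈ 𝔪_R`
  have hdiv : ∀ y : R, y ∈ maximalIdeal R →
      ∃ hy : (y : K) / x ∈ R', g' ⟨(y : K) / x, hy⟩ = g y / g x := by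
    intro y hy
    have hyx : (y : K) / x ∈ R' := div_mem_of_mem_maximalIdeal hR' hy
    refine ⟨hyx, ?_⟩
    have h1 : Subring.inclusion h.le y = ⟨(y : K) / x, hyx⟩ * Subring.inclusion h.le x := by
      apply Subtype.ext
      simp only [Subring.coe_mul, Subring.coe_inclusion]
      rw [div_mul_cancel₀ _ hx0']
    rw [eq_div_iff hgx0, ← hgg' y, h1, map_mul, hgg' x]
  -- the chart `g(R)[𝔪/g x]` lies in `g'(R')`
  have hchart : blowupRing g.range (xb : κ) ≤ g'.range := by
    refine Subring.closure_le.mpr ?_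
    rintro z (hz | ⟨yb, hyb, rfl⟩)
    · exact hle hz
    · obtain ⟨y, rfl⟩ := g.rangeRestrict_surjective yb
      have hy : y ∈ maximalIdeal R := (rangeRestrict_mem_maximalIdeal_iff g y).mp hyb
      obtain ⟨hyx, hg'⟩ := hdiv y hy
      exact ⟨⟨(y : K) / x, hyx⟩, by rw [hg']; rfl⟩
  -- the image of the chart `R[𝔪/x] ⊆ R'` lies in the chart `g(R)[𝔪/g x]`
  have hblowR' : blowupRing R (x : K) ≤ R' := hR' ▸ le_locAtCentre _ O
  have himg : ∀ (y : K) (hy : y ∈ blowupRing R (x : K)),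
      g' ⟨y, hblowR' hy⟩ ∈ blowupRing g.range (xb : κ) := by
    -- the set of elements of `R'` mapping into the chart is a subring of `K` containing the generators
    have key : blowupRing R (x : K) ≤ ((blowupRing g.range (xb : κ)).comap g').map R'.subtype := by
      refine Subring.closure_le.mpr ?_
      rintro z (hz | ⟨y, hy, rfl⟩)
      · refine ⟨⟨z, h.le hz⟩, ?_, rfl⟩
        change g' (Subring.inclusion h.le ⟨z, hz⟩) ∈ blowupRing g.range (xb : κ)
        rw [hgg']
        exact le_blowupRing _ _ ⟨⟨z, hz⟩, rfl⟩
      · obtain ⟨hyx, hg'⟩ := hdiv y hy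
        refine ⟨⟨(y : K) / x, hyx⟩, ?_, rfl⟩
        change g' ⟨(y : K) / x, hyx⟩ ∈ blowupRing g.range (xb : κ)
        rw [hg']
        have hyb : g.rangeRestrict y ∈ maximalIdeal g.range := (rangeRestrict_mem_maximalIdeal_iff g y).mpr hy
        exact div_mem_blowupRing (xb : κ) hyb
    intro y hy
    obtain ⟨y', hy', hyy'⟩ := key hy
    have : (⟨y, hblowR' hy⟩ : R') = y' := Subtype.ext hyy'.symm
    rw [this]
    exact hy'
  refine ⟨‹_›, xb, hxb𝔪, hxb0, ‹_›, hchart, ?_, ?_⟩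
  · -- fractions
    rintro _ ⟨r', rfl⟩
    have hr' : (r' : K) ∈ locAtCentre (blowupRing R (x : K)) O := hR' ▸ r'.2
    obtain ⟨y, hy, w, hw, hvw, hyw⟩ := mem_locAtCentre_iff.mp hr'
    have hwunit : IsUnit (⟨w, hblowR' hw⟩ : R') := isUnit_of_valuation_eq_one h hvw
    have hgw0 : g' ⟨w, hblowR' hw⟩ ≠ 0 := (hwunit.map g').ne_zero
    have hr'eq : r' * ⟨w, hblowR' hw⟩ = ⟨y, hblowR' hy⟩ := by
      apply Subtype.ext
      simp only [Subring.coe_mul]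
      rw [hyw, div_mul_cancel₀ _ (ne_zero_of_valuation_eq_one hvw)]
    refine ⟨g' ⟨y, hblowR' hy⟩, himg y hy, g' ⟨w, hblowR' hw⟩, himg w hw, ?_, ?_⟩
    · obtain ⟨u, hu⟩ := hwunit
      refine ⟨(↑(u⁻¹) : R'), ?_⟩
      apply eq_inv_of_mul_eq_one_right
      rw [← hu, ← map_mul, Units.mul_inv, map_one]
    · rw [eq_div_iff hgw0, ← map_mul, hr'eq]
  · exact range_dominates g g' h.le h.target_le hRO hgg'

end Residue

end Summit.ResolutionOfSingularities.ResolutionOfSingularities.Theorems.SwitchingDichotomy.CurveEscape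

end
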